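import Literature.Probability.RandomPlanarGeometry.SLETransienceZeroOne
import HarnessLib

/-!
# Transience of the SLE trace from positive probability of `0 ∉ cl γ[t₀, ∞)` at an arbitrary time

Trunk T-STOCH. A complement to `SLETransienceZeroOne`: the reduction of Rohde–Schramm's
Theorem 7.1 (*Basic properties of SLE*, Ann. of Math. 161 (2005)) to the positive-probability
statement "`0 ∉ cl γ[t₀, ∞)` with positive probability" for ANY fixed time `t₀` (the original file
has `t₀ = 1`), and its hull form "`K_{t₀} ⊇ {z ∈ ℍ : |z| < ε}` with positive probability". The
proof is the one of `tendsto_norm_sleTrace_atTop_of_measure_ne_zero` with `1` replaced by `t₀`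
(scale invariance in law of the trace, `identDistrib_sleTrace_scale_of_hasSLETrace`, applied to the
measurable events `nearZeroAfter`, and the zero-one law
`measure_setOf_tendsto_norm_sleTrace_zero_or_one`). It is the form in which the conclusion of the
proof of Lemma 7.3 for `4 < κ < 8` ("with positive probability there is some `t > 0` such that
`0 ∉ cl H_t`", p. 910) is consumed.

## References

* S. Rohde, O. Schramm, *Basic properties of SLE*, Ann. of Math. 161 (2005), proof of Thm. 7.1
  (p. 911) and of Lemma 7.3 (p. 910).
-/

noncomputable section

open Set Filter Topology MeasureTheory ProbabilityTheory Metric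
open UpperHalfPlane (upperHalfPlaneSet isOpen_upperHalfPlaneSet)
open scoped NNReal ENNReal

namespace Literature.Probability.RandomPlanarGeometry

variable {κ : ℝ≥0}

/-- **Rohde–Schramm's Theorem 7.1 reduced to positive probability at an arbitrary time `t₀`.**
Let SLE_κ be a.s. generated by a curve (`HasSLETrace κ`). If `0 ∉ cl γ[t₀, ∞)` with positive
probability, then almost surely `|γ(t)| → ∞`. (The proof of
`tendsto_norm_sleTrace_atTop_of_measure_ne_zero`, `SLETransienceZeroOne`, with the time `1`
replaced by `t₀`: scale invariance of the trace in law applied to the events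
"`|γ(s)| < r` for some `s ≥ t`", and the zero-one law.) This is the form needed when the origin is
shown to be sealed with positive probability by some (random, but a.s. finite) time.
[cite: RohdeSchramm2005, proof of Thm 7.1 (p. 911) and of Lemma 7.3 (p. 910)] -/
theorem tendsto_norm_sleTrace_atTop_of_measure_ne_zero_at (hκ : HasSLETrace κ) (t₀ : ℝ≥0)
    (hpos : Process.preWienerMeasure {ω | (0 : ℂ) ∉ closure (sleTrace κ ω '' Ici t₀)} ≠ 0) :
    ∀ᵐ ω ∂Process.preWienerMeasure, Tendsto (fun t ↦ ‖sleTrace κ ω t‖) atTop atTop := by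
  haveI : IsProbabilityMeasure Process.preWienerMeasure := Process.isProbabilityMeasure_preWienerMeasure
    (Process.isProjectiveLimit_preWienerMeasure_of Process.exists_isProjectiveLimit_holds)
  set μ : Measure (ℝ≥0 → ℝ) := Process.preWienerMeasure with hμ
  set Φ : (ℝ≥0 → ℝ) → ℝ≥0 → ℂ := fun ω ↦ sleTrace κ ω with hΦ_def
  have hscale : ∀ {c : ℝ≥0}, c ≠ 0 →
      IdentDistrib (fun ω ↦ sleTrace κ ω) (fun ω t ↦ (c : ℂ) * sleTrace κ ω (t / c ^ 2)) μ μ :=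
    fun hc ↦ identDistrib_sleTrace_scale_of_hasSLETrace hκ hc
  have hΦ : AEMeasurable Φ μ := (hscale one_ne_zero).aemeasurable_fst
  have hcont : ∀ᵐ ω ∂μ, Continuous (Φ ω) := by
    filter_upwards [ae_isGeneratedByCurve_sleTrace hκ] with ω hω using hω.continuous
  -- the events `A n = {∃ s ≥ t₀, |γ(s)| < 1/(n+1)}` decrease to `{0 ∈ cl γ[t₀, ∞)}`, of measure `< 1`
  set A : ℕ → Set (ℝ≥0 → ℝ) := fun n ↦ Φ ⁻¹' nearZeroAfter t₀ (1 / ((n : ℝ) + 1)) with hA_def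
  have hA_null : ∀ n, NullMeasurableSet (A n) μ := fun n ↦
    hΦ.nullMeasurableSet_preimage (measurableSet_nearZeroAfter _ _)
  have hA_anti : Antitone A := by
    intro m n hmn
    refine preimage_mono (nearZeroAfter_mono t₀ ?_)
    have hm1 : (0 : ℝ) < (m : ℝ) + 1 := by positivity
    exact one_div_le_one_div_of_le hm1 (by exact_mod_cast Nat.add_le_add_right hmn 1)
  set Z : Set (ℝ≥0 → ℝ) := {ω | (0 : ℂ) ∉ closure (sleTrace κ ω '' Ici t₀)} with hZ
  have hZeq : (⋂ n, A n) =ᵐ[μ] (Zᶜ : Set (ℝ≥0 → ℝ)) := by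
    rw [eventuallyEq_set]
    filter_upwards [hcont] with ω hc
    rw [mem_iInter, mem_compl_iff]
    change (∀ n, ω ∈ A n) ↔ ¬ ((0 : ℂ) ∉ closure (sleTrace κ ω '' Ici t₀))
    rw [not_not]
    constructor
    · intro hmem
      rw [Metric.mem_closure_iff]
      intro ε hε
      obtain ⟨n, hn⟩ := exists_nat_one_div_lt hε
      have h := hmem n
      change ω ∈ Φ ⁻¹' nearZeroAfter t₀ (1 / ((n : ℝ) + 1)) at h
      rw [mem_preimage, mem_nearZeroAfter_iff hc] at h
      obtain ⟨s, hs, hlt⟩ := h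
      refine ⟨Φ ω s, mem_image_of_mem _ (mem_Ici.2 hs), ?_⟩
      rw [dist_comm, dist_zero_right]
      exact hlt.trans hn
    · intro hmem n
      change ω ∈ Φ ⁻¹' nearZeroAfter t₀ (1 / ((n : ℝ) + 1))
      rw [mem_preimage, mem_nearZeroAfter_iff hc]
      rw [Metric.mem_closure_iff] at hmem
      obtain ⟨b, ⟨s, hs, rfl⟩, hdist⟩ := hmem _ (by positivity : (0 : ℝ) < 1 / ((n : ℝ) + 1))
      rw [dist_comm, dist_zero_right] at hdist
      exact ⟨s, hs, hdist⟩
  have hZnull : NullMeasurableSet Z μ := by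
    have h : NullMeasurableSet (Zᶜ : Set (ℝ≥0 → ℝ)) μ :=
      (NullMeasurableSet.iInter hA_null).congr hZeq
    simpa using h.compl
  have hA_inter_lt : μ (⋂ n, A n) < 1 := by
    rw [measure_congr hZeq, prob_compl_eq_one_sub₀ hZnull]
    exact ENNReal.sub_lt_self ENNReal.one_ne_top one_ne_zero hpos
  have hA_tendsto : Tendsto (fun n ↦ μ (A n)) atTop (𝓝 (μ (⋂ n, A n))) :=
    tendsto_measure_iInter_atTop hA_null hA_anti ⟨0, measure_ne_top μ _⟩
  -- by scaling, `X N = {∀ m, ∃ s ≥ m, |γ(s)| < N + 1}` has measure `≤ μ (A n)` for every `n`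
  have hX : ∀ N n : ℕ, μ (⋂ m : ℕ, Φ ⁻¹' nearZeroAfter (m : ℝ≥0) ((N : ℝ) + 1)) ≤ μ (A n) := by
    intro N n
    -- scale `c = (N+1)(n+1)+1`, time `c²`, radius `c/(n+1) ≥ N+1`
    set k : ℕ := (N + 1) * (n + 1) + 1 with hk
    set c : ℝ≥0 := (k : ℝ≥0) with hc_def
    have hk0 : k ≠ 0 := by omega
    have hc0 : c ≠ 0 := by rw [hc_def]; exact_mod_cast hk0
    have hcR : (c : ℝ) = ((N : ℝ) + 1) * ((n : ℝ) + 1) + 1 := by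
      rw [hc_def, NNReal.coe_natCast, hk]; push_cast; ring
    have hn1 : (0 : ℝ) < (n : ℝ) + 1 := by positivity
    have hrad : (N : ℝ) + 1 ≤ (c : ℝ) * (1 / ((n : ℝ) + 1)) := by
      rw [hcR, mul_one_div, le_div_iff₀ hn1]
      linarith
    have htime : c ^ 2 * t₀ ≤ ((k ^ 2 * (⌈(t₀ : ℝ)⌉₊ + 1) : ℕ) : ℝ≥0) := by
      rw [hc_def, Nat.cast_mul, Nat.cast_pow]
      gcongr
      have h1 : (t₀ : ℝ) ≤ ⌈(t₀ : ℝ)⌉₊ := Nat.le_ceil _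
      rw [← NNReal.coe_le_coe]
      push_cast
      linarith
    calc μ (⋂ m : ℕ, Φ ⁻¹' nearZeroAfter (m : ℝ≥0) ((N : ℝ) + 1))
        ≤ μ (Φ ⁻¹' nearZeroAfter ((k ^ 2 * (⌈(t₀ : ℝ)⌉₊ + 1) : ℕ) : ℝ≥0) ((N : ℝ) + 1)) :=
          measure_mono (iInter_subset _ (k ^ 2 * (⌈(t₀ : ℝ)⌉₊ + 1)))
      _ ≤ μ (Φ ⁻¹' nearZeroAfter (c ^ 2 * t₀) ((c : ℝ) * (1 / ((n : ℝ) + 1)))) :=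
          measure_mono (preimage_mono
            ((nearZeroAfter_anti htime _).trans (nearZeroAfter_mono _ hrad)))
      _ = μ ((fun ω t ↦ (c : ℂ) * sleTrace κ ω (t / c ^ 2)) ⁻¹'
            nearZeroAfter (c ^ 2 * t₀) ((c : ℝ) * (1 / ((n : ℝ) + 1)))) :=
          (hscale hc0).measure_mem_eq (measurableSet_nearZeroAfter _ _)
      _ = μ (A n) := by
          refine measure_congr ?_
          filter_upwards [hcont] with ω hω
          exact propext (scale_mem_nearZeroAfter_iff hω hc0)
  have hXle : ∀ N : ℕ, μ (⋂ m : ℕ, Φ ⁻¹' nearZeroAfter (m : ℝ≥0) ((N : ℝ) + 1)) ≤ μ (⋂ n, A n) :=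
    fun N ↦ ge_of_tendsto' hA_tendsto (hX N)
  -- the complement of the transience event `E` is a.s. covered by `⋃ N, X N`
  set E : Set (ℝ≥0 → ℝ) := {ω | Tendsto (fun t ↦ ‖sleTrace κ ω t‖) atTop atTop} with hE
  have hmonoX : Monotone fun N : ℕ ↦ ⋂ m : ℕ, Φ ⁻¹' nearZeroAfter (m : ℝ≥0) ((N : ℝ) + 1) := by
    intro N N' hNN'
    exact iInter_mono fun m ↦ preimage_mono (nearZeroAfter_mono _ (by exact_mod_cast Nat.add_le_add_right hNN' 1))
  have hEc : μ Eᶜ < 1 := by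
    have hsub : ∀ᵐ ω ∂μ, ω ∈ Eᶜ → ω ∈ ⋃ N : ℕ, ⋂ m : ℕ, Φ ⁻¹' nearZeroAfter (m : ℝ≥0) ((N : ℝ) + 1) := by
      filter_upwards [hcont] with ω hc hω
      simp only [hE, mem_compl_iff, mem_setOf_eq, tendsto_atTop_atTop, not_forall, not_exists,
        not_le] at hω
      obtain ⟨b, hb⟩ := hω
      obtain ⟨N, hN⟩ := exists_nat_ge b
      refine mem_iUnion.2 ⟨N, mem_iInter.2 fun m ↦ ?_⟩
      rw [mem_preimage, mem_nearZeroAfter_iff hc]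
      obtain ⟨s, hms, hlt⟩ := hb m
      exact ⟨s, hms, by linarith⟩
    calc μ Eᶜ ≤ μ (⋃ N : ℕ, ⋂ m : ℕ, Φ ⁻¹' nearZeroAfter (m : ℝ≥0) ((N : ℝ) + 1)) :=
          measure_mono_ae hsub
      _ = ⨆ N : ℕ, μ (⋂ m : ℕ, Φ ⁻¹' nearZeroAfter (m : ℝ≥0) ((N : ℝ) + 1)) :=
          hmonoX.measure_iUnion
      _ ≤ μ (⋂ n, A n) := iSup_le hXle
      _ < 1 := hA_inter_lt
  -- zero-one
  have hEnull : NullMeasurableSet E μ := nullMeasurableSet_setOf_tendsto_norm_sleTrace hκ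
  have hE1 : μ E = 1 := by
    have h01 := measure_setOf_tendsto_norm_sleTrace_zero_or_one hκ
    rw [← hμ, ← hE] at h01
    rcases h01 with h0 | h1
    · exfalso
      have : μ Eᶜ = 1 := by rw [prob_compl_eq_one_sub₀ hEnull, h0, tsub_zero]
      exact (lt_irrefl _) (this ▸ hEc)
    · exact h1
  have hEc0 : μ Eᶜ = 0 := by rw [prob_compl_eq_one_sub₀ hEnull, hE1, tsub_self]
  exact mem_ae_iff.2 hEc0


/-- **Positive probability of a sealed half-disc at any fixed time suffices**: if SLE_κ is a.s.
generated by a curve and, with positive probability, the hull `K_{t₀}` contains a half-disc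
`{z ∈ ℍ : |z| < ε}`, then the trace is a.s. transient (`|γ(s)| ≥ ε` for `s ≥ t₀`,
`Loewner.IsGeneratedByCurve.le_norm_of_subset_hull`). [cite: RohdeSchramm2005, Lemma 7.3 and proof of Thm 7.1 (p. 911)] -/
theorem tendsto_norm_sleTrace_atTop_of_measure_halfDisc_ne_zero_at (hκ : HasSLETrace κ) (t₀ : ℝ≥0)
    (h : Process.preWienerMeasure
      {ω | ∃ ε : ℝ, 0 < ε ∧ {z ∈ upperHalfPlaneSet | ‖z‖ < ε} ⊆ sleHull κ ω t₀} ≠ 0) :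
    ∀ᵐ ω ∂Process.preWienerMeasure, Tendsto (fun t ↦ ‖sleTrace κ ω t‖) atTop atTop := by
  refine tendsto_norm_sleTrace_atTop_of_measure_ne_zero_at hκ t₀ fun h0 ↦ h ?_
  have hsub : ∀ᵐ ω ∂Process.preWienerMeasure,
      ω ∈ {ω | ∃ ε : ℝ, 0 < ε ∧ {z ∈ upperHalfPlaneSet | ‖z‖ < ε} ⊆ sleHull κ ω t₀} →
        ω ∈ {ω | (0 : ℂ) ∉ closure (sleTrace κ ω '' Ici t₀)} := by
    filter_upwards [ae_isGeneratedByCurve_sleTrace hκ] with ω hω hε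
    obtain ⟨ε, hε, hK⟩ := hε
    rw [Metric.mem_closure_iff]
    push Not
    refine ⟨ε, hε, ?_⟩
    rintro _ ⟨s, hs, rfl⟩
    rw [dist_comm, dist_zero_right]
    exact hω.le_norm_of_subset_hull (continuous_sleDriving κ ω) hK hs
  exact le_antisymm ((measure_mono_ae hsub).trans h0.le) bot_le

end Literature.Probability.RandomPlanarGeometry
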